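import Mathlib
import HarnessLib
import HarnessLib.Audit
import Summits.KontsevichZagierPeriods.Statement
import HarnessLib.Audit.Status.Attr

/-!
Route: RealPeriodGerms

DORMANT since 2026-08-23T15:58:51Z (reconciler: no traction for 6.1 d (last activity item-proof-filed at 2026-08-17T12:52:41Z); parked, not closed — `ledger route dormant route-KontsevichZagierPeriods-RealPeriodGerms --off` to reactivat) — unstaffed, not closed; items shared with open routes are served there. `ledger route dormant <id> --off` reactivates.

# Route RealPeriodGerms — The period germ is a complete move-invariant of the real-coefficient KZ
calculus; Conjecture 1 is its fibre over the rationals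

RISING SEA OVER THE COEFFICIENTS (card real-coefficient-period-germs, absorbing the retired siblings
kaehler-defect-real-coefficients and dehn-invariant-is-d-of-period-germ). Run the four moves of
`Literature.NumberTheory.Transcendental.KZCalculus` with ℝ-semialgebraic data (calculus KZ_ℝ ⊇ KZ_ℚ;
encoded inline in every item by the three `let`s `Adm` (ℝ-semialgebraic + absolutely integrable pair
(σ,f)), `gen` (generator of the free abelian group on pairs) and `Rel` (subgroup generated by the
four ℝ-move sets, verbatim copies of
`KZ.domainAddRel/integrandAddRel/changeOfVariablesRel/newtonLeibnizRel` with ℚ ↦ ℝ)). An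
ℝ-representation is the fibre at a real parameter point p ∈ ℝ^N of a ℚ-semialgebraic family (D ⊆
ℝ^{n+N}, F); its PERIOD GERM is the germ at p of the value function z ↦ ∫_{D_z} F_z restricted to
the ℚ-locus Loc(p) = {z | every ℚ-polynomial vanishing at p vanishes at z} (the real points of the
ℚ-Zariski closure of p). It suffices to show X = GermComplete ∧ RealTransfer: (GermComplete, the
corrected real Conjecture 1 = 'Sydler_ℝ') two fibres whose value functions agree near p on Loc(p)
differ by an element of Rel; (RealTransfer) for ℚ-representations an ℝ-certificate descends to a
ℚ-certificate. The soundness half GermSound (germ ≡ 0 on Rel: the germ IS an invariant) and the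
calibration NotNaiveRealKZ (unit disc vs the constant π: equal values, different germs, so naive
ℝ-Conjecture 1 is false and the correction is forced) are the unconditional theorems the line
produces; IntegrabilityLocus (ℚ-semialgebraicity of absolute-convergence loci of ℚ-families;
Comte–Lion–Rolin/Kaiser) is the one named-fact-type input and is ranked first.
Lean: `GermComplete ∧ RealTransfer` — both conjuncts are the one-line bodies of the items below
(folder Sketch.lean / OneLine.lean rc 0; `example : Assembly = (GermComplete → RealTransfer →
KontsevichZagierPeriods) := rfl` elaborates).

Assembly in words: at a ℚ-point (N = 0, or p rational) Loc(p) = {p} and the germ is the value, so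
GermComplete applied to two ℚ-representations r, r' with r.value = r'.value (families D := r.domain,
F := r.integrand over ℝ^{n+0}) gives gen r − gen r' ∈ Rel, RealTransfer turns it into KZ.of r −
KZ.of r' ∈ KZ.relations = KZ.Equivalent r r', which is the summit `KontsevichZagierPeriods`
(two-representation form). Bookkeeping only: `Fin.append x Fin.elim0 = x` up to `Fin.cast`,
ℚ-semialgebraicity is preserved by the identification Fin (n+0) = Fin n.

## Assembly
GermComplete at ℚ-points (N = 0: Loc = the point, germ hypothesis = equality of the two values)
gives an ℝ-certificate for any two equal-valued ℚ-representations; RealTransfer descends it to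
KZ.relations; that is KZ.Equivalent r r', i.e. the summit in its two-representation form. Pure logic
plus `Fin (n+0) = Fin n` bookkeeping; the inline calculus is shared by one `let` so that `Assembly =
(GermComplete → RealTransfer → KontsevichZagierPeriods)` holds by `rfl`.

Rationale: WHY THIS LINE. Every structural route on this summit (Nori, Grothendieck, Ayoub) meets the same
wall: over ℚ̄ there is no known invariant of a formal combination of integrals other than its value,
and Ayoub's relative theorems (Ayoub2015 Thm 4.25 = AyoubRelKZRevisited Thm 1.1, valid only when π
is algebraic over k, Rem. 1.3; Thm 1.7) are functional statements whose type-(b) generators f·L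
re-absorb the whole absolute kernel (pivot note of route AyoubSpecialisation). Letting the
COEFFICIENTS be real changes this: parameters can move along their ℚ-locus, and o-minimal genericity
(a ℚ-semialgebraic set containing a point contains a neighbourhood of it in its ℚ-locus: support
GenericNeighbourhood; integrability loci are ℚ-semialgebraic: Kaiser2005 Thm 2.1,
ComteLionRolin2000, LionRolin1998; canonical parameters/elimination of imaginaries for RCF:
Dries1998) makes the germ of the value function a MOVE INVARIANT (GermSound) — the first invariant
of a Kontsevich–Zagier-type calculus that is not a number, the 'Dehn invariant' Cresson–Viu-Sos ask
for (CressonViusos2022 §2.2, where the ℝ-coefficient classification is called intractable after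
Blass–Schanuel), and it is invisible exactly over ℚ̄ (loci are points), which explains structurally
why invariant searches over ℚ̄ (route Neg 0313) come back empty. Imported areas:
o-minimal/real-algebraic geometry (genericity, definability of integrability, Tarski transfer: tree
facts `tarski_seidenberg_real_holds`, `isSemialgebraic_iff_exists_finset_basic_holds`),
scissors-congruence template (Dehn–Sydler–Jessen: invariant, completeness, splitting), Lindemann
(`transcendental_pi_holds`) for the calibration. What it does that prior routes do not: a new OBJECT
(KZ_ℝ with its germ invariant), two unconditional theorems (GermSound, NotNaiveRealKZ), a transfer
theorem (RealTransfer, shared in spirit with card definable-move-relation-tarski-transfer (T)), and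
a corrected conjecture GermComplete of which Conjecture 1 is the fibre over ℚ and whose other fibres
are statements about transcendental parameter points organised by transcendence degree. Correction
to the card recorded here: its claim that the generic rung 'is Ayoub's theorem + transfer' does not
survive inspection (Thm 1.1's (b)-terms reintroduce absolute kernel elements over k = ℚ(p, π); Thm
1.7 is cube/polynomial-coefficient only), so the generic and hypersurface rungs are left NOT
DECOMPOSED; instead we record the PROPAGATION PRINCIPLE (from GenericNeighbourhood + RealTransfer's
descent): a certificate at a ℚ-generic parameter point has a ℚ-semialgebraic validity set, hence
certifies all nearby ALGEBRAIC members of the family — generic-point completeness implies Conjecture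
1 on a dense open set of algebraic parameters of the family, and conversely locally bounded
certificate complexity at algebraic points implies generic completeness (Baire + definability).

RANKED CRUXES. #2 IntegrabilityLocus (crux) — For a ℚ-semialgebraic family (D ⊆ ℝ^{n+N}, F
ℚ-semialgebraic on D) the set of parameters z ∈ ℝ^N at which the fibre integrand x ↦ F(x,z) is
absolutely integrable on the fibre D_z is ℚ-semialgebraic (parameter-free!). The single
non-first-order side condition of the moves; input of GermSound and RealTransfer. Ranked first
because it is the named-fact-type input of the mechanism (D-0019: fact first). [difficulty: XL] (why
it might fail: Printed: definable WITH real parameters (Comte–Lion–Rolin over ℝ) or one-variable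
integrals over archimedean RCF (Kaiser2005 Thm 2.1); the parameter-free multivariable form must be
re-extracted from the proofs (uniform cell decomposition/preparation); no o-minimal integration in
Lean (XL).) [Kaiser2005, ComteLionRolin2000, LionRolin1998, Dries1998, CluckersMiller2011]
#3 GermSound (crux) — (card D1) THE GERM IS A MOVE INVARIANT. If the fibres at p of two
ℚ-semialgebraic families are absolutely integrable and their difference lies in Rel (the
ℝ-relations), then on a neighbourhood of p inside Loc(p) both fibres stay integrable and their
integrals agree identically. Proof plan: spread the certificate over the ℚ-locus of its own
parameter point e ⊇ p; every side condition of every move is ℚ-definable in the parameters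
(first-order, plus IntegrabilityLocus), so by GenericNeighbourhood it holds on a
Loc(e)-neighbourhood of e; soundness of each move pointwise (tree proofs
`KZ.eval_eq_zero_of_mem_*_holds` transposed to ℝ-data) gives the value identity along Loc(e); Loc(e)
→ Loc(p) is submersive at e (char-0 generic smoothness at a ℚ-generic point), hence open. [deps:
IntegrabilityLocus, GenericNeighbourhood] [difficulty: XL] (why it might fail: Absolute convergence
is the one non-first-order move condition: if IntegrabilityLocus fails over ℚ, a certificate may
pass through reps integrable at e only; also needs generic submersivity Loc(e)→Loc(p) and real
smoothness of ℚ-loci at their generic point (char 0; believed routine).) [Dries1998, Kaiser2005,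
ComteLionRolin2000, KontsevichZagier2001, BochnakCosteRoy1998]
#4 RealTransfer (crux) — (card (T)) REAL CERTIFICATES DESCEND. For ℚ-representations r, r' (tree
`KZ.IntegralRep`), if gen r − gen r' ∈ Rel (an ℝ-coefficient certificate exists) then KZ.of r −
KZ.of r' ∈ KZ.relations. Proof plan: fix the certificate's shape; the set E of real parameter values
making it valid is ℚ-semialgebraic (first-order conditions + IntegrabilityLocus; coincidences of
fibres are ℚ-definable) and non-empty, hence has a real-algebraic point (ℝ_alg ≺ ℝ, tree
`tarski_seidenberg_real_holds`); fibres at a real-algebraic point are ℚ-semialgebraic, so the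
certificate there is a KZ_ℚ certificate. [deps: IntegrabilityLocus] [difficulty: L] (why it might
fail: Needs the validity set of a certificate shape to be ℚ-semialgebraic (absolute convergence of
intermediate reps: IntegrabilityLocus) and fibres of ℚ-families at real-algebraic points to be
ℚ-semialgebraic; a certificate whose validity set had no algebraic point would break it.)
[BochnakCosteRoy1998, Dries1998, Kaiser2005, KontsevichZagier2001]
#5 GermComplete (crux) — (card D3, 'ℝ-KZ″' / Sydler_ℝ) THE GERM IS COMPLETE. If the value functions
of two ℚ-semialgebraic families agree (with integrable fibres) on a neighbourhood of p inside
Loc(p), then the difference of the fibres at p lies in Rel. At ℚ-points (Loc = point) this IS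
Conjecture 1 in kernel form up to ℝ-certificates — said plainly: the item contains the summit; its
other fibres (p of positive transcendence degree) are new statements, and the card's kill test c =
(L−1)⋆(L−1), L = [(1,e),1/t] (germ (log z − 1)² ≢ 0) is consistent. Staffed mainly for refuters
(negative twin: an ℝ-pair with equal germs separated by a finer invariant) and for the rung
analysis. [deps: GermSound] [difficulty: open-problem] (why it might fail: Contains Conjecture 1
(GPC-strength). Beyond: an ℝ-pair with identical germs but no ℝ-certificate — e.g. a functional
identity at a transcendental point whose parameter-direction primitive is not semialgebraic and
admits no algebraic base point — or a finer invariant (jets along non-algebraic arcs).)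
[KontsevichZagier2001, AyoubRelKZRevisited, Ayoub2015, CressonViusos2022, Andre2004]
#9 GenericNeighbourhood (support) — A ℚ-semialgebraic subset of ℝ^N containing p contains U ∩ Loc(p)
for some neighbourhood U of p (induction over the Boolean algebra on the two-sided statement 'germ
of Loc(p) at p lies inside A or inside Aᶜ'; generators {q = 0}, {q > 0} by cases on the sign of
q(p)). Provable now; the genericity engine of GermSound and of the propagation principle.
[difficulty: S] [Dries1998, BochnakCosteRoy1998]
#9 NotNaiveRealKZ (support) — (card D2) NAIVE ℝ-CONJECTURE 1 IS FALSE: the unit disc with integrand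
1 and the 0-dimensional representation 'the constant π' have the same value π but their difference
is not in Rel — the area of the disc cannot be EVALUATED by real-coefficient moves. From GermSound
with N = 1, p = (π): Loc(π) = ℝ by `transcendental_pi_holds`, the disc family is constant (germ ≡ π)
while the constant family has germ z ↦ z. Equivalently (0,π)×(0,1) vs disc. The Lindemann theorem
read through a Dehn-type invariant. [difficulty: M] [KontsevichZagier2001, CressonViusos2022]

TWO-LAYER PLAN. Foreseen splits, filed only after a crux closes: GermSound ⇐
(MoveValiditySetsDefinable: the validity set of each of the four move shapes over a ℚ-family is
ℚ-semialgebraic) → (GenericSubmersion: Loc(e) → Loc(p) open at e) → GermSound. GermComplete ⇐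
(HypersurfaceRung: parameter points of transcendence degree dim(type) − 1) → (GenericRung ⇔ locally
bounded certificate complexity along families, by the propagation principle) → … only once GermSound
and RealTransfer have landed. RealTransfer ⇐ (CertificateShapeDefinable) → (AlgebraicPointsOfQSets:
non-empty ℚ-semialgebraic sets have real-algebraic points; fibres there are ℚ-semialgebraic) →
RealTransfer.

KILL CRITERIA. A proof of ¬GermSound (an ℝ-chain joining the unit disc to the constant π, or any
equal-value/different-germ pair) closes the route outright (close --reason refuted:GermSound) and
locates a move side condition that is not ℚ-definable. ¬RealTransfer (an ℝ-certificate for ℚ-data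
with no ℚ-certificate) closes the route and hands route Neg a witness shape. ¬GermComplete by a pair
with equal germs and a finer separating invariant forces a PIVOT to 'germ + that invariant' (restate
GermComplete), not a close; ¬GermComplete at a ℚ-point is ¬KontsevichZagierPeriods.
¬IntegrabilityLocus (a ℚ-family whose convergence locus is not ℚ-semialgebraic) forces restating
GermSound/RealTransfer with integrability hypotheses along the locus.

NOT DECOMPOSED YET. The intermediate rungs of GermComplete (generic points of the full parameter
space of a combinatorial type; hypersurface loci) — the card's claim that the generic rung follows
from Ayoub's theorems is withdrawn here (AyoubRelKZRevisited Thm 1.1 needs π algebraic over k and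
its type-(b) generators reintroduce absolute kernel elements; Thm 1.7 is cube/polynomial only), so
they wait for GermSound/RealTransfer and for a precise 'uniform certificate' notion. The germ as an
OBJECT (an additive map from FormalRep_ℝ to germs; its differential d𝒥 ∈ Ω¹_{ℝ/ℚ} = the Kähler/Dehn
shadow of the sibling cards, Schläfli/Jessen comparisons) — definition request below, no items. The
top rung D4 (ℝ_an,exp-constructible data, where completeness is a theorem by Cluckers–Miller
stability under integration: every representation reduces to its value-constant by Newton–Leibniz
along the last variable) is calibration in another calculus, not an item. General finite
combinations (beyond pairs) and the product structure are left to provers' lemmas (`--supports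
GermSound`).

CHEAPEST FALSIFIER. Try to write an explicit KZ_ℝ chain from the unit disc [x²+y²≤1, 1] to the
constant [pt, π] (or to [(0,π)×(0,1), 1]): KZ's own chain disc → [(-1,1), 2√(1−x²)] → [(-1,1),
1/√(1−x²)] → [ℝ, 1/(1+x²)] stalls exactly at a transcendental primitive (arcsin/arctan), as
GermSound predicts; any success kills GermSound and the route. Second cheapest: re-derive from
Kaiser2005 §2 / Comte–Lion–Rolin that the convergence locus of the Newton–Leibniz band and
change-of-variables shapes over a ℚ-family is ℚ-definable (the only place the soundness argument can
leak). I ran the first by hand (stalls as predicted) and checked all seven statements elaborate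
(Sketch.lean rc 0).

NUMBERS. None: the line is qualitative. Calibration values: value(disc) = π (transcendental, tree
`transcendental_pi_holds`); kill-test germ (log z − 1)² at z = e.

DEFINITION REQUESTS. KZOver (topic Literature/NumberTheory/Transcendental): the KZ calculus over a
coefficient ring k with [Algebra k ℝ] — `KZCalculus.lean` verbatim with `IsSemialgebraic k /
IsSemialgebraicFunOn k / IsSemialgebraicMapOn k` in place of ℚ (IntegralRep k n, value, FormalRep k,
of, eval, the four move sets, relations k, Equivalent), the base change FormalRep ℚ-calculus →
KZOver ℝ (via `isSemialgebraic_algebra_of_isSemialgebraic`), soundness `relations k ≤ ker eval`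
(same proofs), and the comparison lemma identifying this route's inline `Rel` (raw pairs +
admissibility side conditions) with `KZOver.relations ℝ` on admissible generators. Later (not now):
PeriodGerm — the germ as an additive invariant FormalRep_ℝ → (germs of functions on ℚ-loci), needs
canonical parameters (Dries1998 Ch. 6/8).

Novelty: Searches (2026-08-15): `lit search --hybrid "Kontsevich-Zagier period conjecture real coefficients
semialgebraic"` (10 book hits: Pila2022, HuberWustholz2022, Carlson–Müller-Stach–Peters, none on
real coefficients); `lit search --hybrid "period conjecture field of definition not algebraic
transcendence degree André motives"` (Nesterenko–Philippon, Baker–Wüstholz, Pila, Huber–Wüstholz: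
André-type statements are for MOTIVES over k ⊂ ℂ); `lit search --hybrid "volume of semialgebraic
family finiteness of integral parameters Lion Rolin"` (van den Dries 1998, Basu–Pollack–Roy); `lit
search --source crossref "Kaiser convergence of integrals o-minimal"` → doi:10.4064/ap87-0-14 read
(Thm 2.1, intro citing Comte–Lion–Rolin); `lit read paper:url-66ddb8706258` (Ayoub revisited) pp.
2–4: Thm 1.1 hypothesis π ∈ k^alg, Rem. 1.2–1.3, Thm 1.7; `lit galaxy search "Kontsevich Zagier
period conjecture real coefficients" --star all` (0 rows; panama saturated/queued twice);
OpenAlex/arXiv 429 (rate-limited) this session; the 123 cards of the summit (two siblings with the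
same object already retired into this card by triage). Nearest prior art found: AyoubRelKZRevisited
(doi:10.2748/tmj/1568772181) / Ayoub2015 (doi:10.4007/annals.2015.181.3.2) — functional statements
over a FIXED k, no invariant on a rules-presented group, no statement indexed by the transcendence
degree of the parameter point; CressonViusos2022 (arXiv:1912.01751 §1, §2.2) — names the
ℝ-coefficient problem and wishes for a Dehn-lik  [refs: 10.4064/ap87-0-14, 10.2748/tmj/1568772181, 10.4007/annals.2015.181.3.2, 1912.01751, doi:10.4064/ap87-0-14, paper:url-66ddb8706258, doi:10.2748/tmj/1568772181, doi:10.4007/annals.2015.181.3.2, Pila2022, HuberWustholz2022, Ayoub2015, CressonViusos2022, Andre2004, Kaiser2005, ComteLionRolin2000, Dries1998]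

Barriers (technique_class: invariant, o-minimal, rising-sea, real-coefficients): - technique_class: invariant, o-minimal, rising-sea, real-coefficients
- Literature.Barriers.KontsevichZagierPeriods.kzConjecture_implies_oddZetaAlgIndep: applies in full
to GermComplete (which contains the summit) and is NOT evaded there — the bet is structural (new
provable invariant + transfer + a corrected conjecture with informative non-algebraic fibres); it
does not touch GermSound, RealTransfer, IntegrabilityLocus, NotNaiveRealKZ (no statement about
ℚ̄-periods is made; the only transcendence input is Lindemann, proved in the tree).
- Literature.Barriers.KontsevichZagierPeriods.kzConjecture_implies_twoPiI_log_algIndep: same as the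
previous line (strength barrier on GermComplete only).
- Literature.Barriers.KontsevichZagierPeriods.kzConjecture_implies_ellipticPeriods_algIndep: same
(strength barrier on GermComplete only).
- Literature.Barriers.KontsevichZagierPeriods.noSemialgebraicPrimitive_inv_sub_two: not engaged — no
variable is integrated out; the germ differentiates VALUES along coefficient directions; the barrier
is exactly what NotNaiveRealKZ re-proves by invariant (no real-semialgebraic chain evaluates ∫ over
the disc) and what the ℝ_an,exp calibration dissolves.
- Literature.Barriers.KontsevichZagierPeriods.cressonViuSos_prop_3_2: not engaged (scissors/domain
additivity kept; the invariant is additive and insensitive to PL type).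
- Literature.Barriers.KontsevichZagierPeriods.not_complete_of_undecidable: consistent;
KZ_ℝ-equivalence is not r.e. in any coding of

History (route lifecycle, newest last):
- 2026-08-16T02:17:47Z · AUTO-CRUX: 1 conjecture-grade item(s) promoted to crux (NotNaiveRealKZ) — refuter vetting / tiering apply (operator:999:1362873)
- 2026-08-23T15:58:51Z · DORMANT — reconciler: no traction for 6.1 d (last activity item-proof-filed at 2026-08-17T12:52:41Z); parked, not closed — `ledger route dormant route-KontsevichZagierPer (operator:999:704224)

sub-problem: KontsevichZagierPeriods · status: dormant · opened planner-plancard-KontsevichZagierPeriods-Kont-b26b6b90-0 2026-08-15T11:25:18Z · rev 1 · ledger route-KontsevichZagierPeriods-RealPeriodGerms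
GENERATED by the gate from the ledger (D-0016/17). Provers cite these decls: `theorem foo : Summit.KontsevichZagierPeriods.KontsevichZagierPeriods.Theses.RealPeriodGerms.<Decl> := …` in Summits/KontsevichZagierPeriods/KontsevichZagierPeriods/Theorems/<Name>.lean.
-/

namespace Summit.KontsevichZagierPeriods.KontsevichZagierPeriods.Theses.RealPeriodGerms

open scoped BigOperators Topology Manifold Classical MeasureTheory ProbabilityTheory Matrix InnerProductSpace ComplexConjugate ContinuousMap
open Filter Set Function TopologicalSpace MeasureTheory

attribute [summit_statement] _root_.KontsevichZagierPeriods

open Literature Periods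

/-- item stmt-KontsevichZagierPeriods-3842 · crux · rank 2 · open · by planner
why it might fail: Printed: definable WITH real parameters (Comte–Lion–Rolin over ℝ) or one-variable integrals over archimedean RCF (Kaiser2005 Thm 2.1); the parameter-free multivariable form must be re-extracted from the proofs (uniform cell decomposition/preparation); no o-minimal integration in Lean (XL).
sources: Kaiser2005, ComteLionRolin2000, LionRolin1998, Dries1998, CluckersMiller2011
[crux] For a ℚ-semialgebraic family (D ⊆ ℝ^{n+N}, F ℚ-semialgebraic on D) the set of parameters z ∈
ℝ^N at which the fibre integrand x ↦ F(x,z) is absolutely integrable on the fibre D_z is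
ℚ-semialgebraic (parameter-free!). The single non-first-order side condition of the moves; input of
GermSound and RealTransfer. Ranked first because it is the named-fact-type input of the mechanism
(D-0019: fact first). [difficulty: XL] -/
@[route_item "route-KontsevichZagierPeriods-RealPeriodGerms", crux]
def IntegrabilityLocus : Prop :=
  ∀ (n N : ℕ) (D : Set (Fin (n + N) → ℝ)) (F : (Fin (n + N) → ℝ) → ℝ), Literature.ModelTheory.ExponentialFields.IsSemialgebraic ℚ D → Literature.NumberTheory.Transcendental.IsSemialgebraicFunOn ℚ D F → Literature.ModelTheory.ExponentialFields.IsSemialgebraic ℚ {z : Fin N → ℝ | MeasureTheory.IntegrableOn (fun x : Fin n → ℝ => F (Fin.append x z)) {x : Fin n → ℝ | Fin.append x z ∈ D}}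

/-- item stmt-KontsevichZagierPeriods-3843 · crux · rank 3 · open · by planner
why it might fail: Absolute convergence is the one non-first-order move condition: if IntegrabilityLocus fails over ℚ, a certificate may pass through reps integrable at e only; also needs generic submersivity Loc(e)→Loc(p) and real smoothness of ℚ-loci at their generic point (char 0; believed routine).
sources: Dries1998, Kaiser2005, ComteLionRolin2000, KontsevichZagier2001, BochnakCosteRoy1998
[crux] (card D1) THE GERM IS A MOVE INVARIANT. If the fibres at p of two ℚ-semialgebraic families
are absolutely integrable and their difference lies in Rel (the ℝ-relations), then on a
neighbourhood of p inside Loc(p) both fibres stay integrable and their integrals agree identically.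
Proof plan: spread the certificate over the ℚ-locus of its own parameter point e ⊇ p; every side
condition of every move is ℚ-definable in the parameters (first-order, plus IntegrabilityLocus), so
by GenericNeighbourhood it holds on a Loc(e)-neighbourhood of e; soundness of each move pointwise
(tree proofs `KZ.eval_eq_zero_of_mem_*_holds` transposed to ℝ-data) gives the value identity along
Loc(e); Loc(e) → Loc(p) is submersive at e (char-0 generic smoothness at a ℚ-generic point), hence
open. [deps: IntegrabilityLocus, GenericNeighbourhood] [difficulty: XL] -/
@[route_item "route-KontsevichZagierPeriods-RealPeriodGerms", crux]
def GermSound : Prop :=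
  let Adm : (n : ℕ) → Set (Fin n → ℝ) → ((Fin n → ℝ) → ℝ) → Prop := fun n σ f => Literature.ModelTheory.ExponentialFields.IsSemialgebraic ℝ σ ∧ Literature.NumberTheory.Transcendental.IsSemialgebraicFunOn ℝ σ f ∧ MeasureTheory.IntegrableOn f σ; let gen : (n : ℕ) → Set (Fin n → ℝ) → ((Fin n → ℝ) → ℝ) → FreeAbelianGroup (Σ n : ℕ, Set (Fin n → ℝ) × ((Fin n → ℝ) → ℝ)) := fun n σ f => FreeAbelianGroup.of ⟨n, (σ, f)⟩; let Rel : AddSubgroup (FreeAbelianGroup (Σ n : ℕ, Set (Fin n → ℝ) × ((Fin n → ℝ) → ℝ))) := AddSubgroup.closure ({c | ∃ (n : ℕ) (σ σ₁ σ₂ : Set (Fin n → ℝ)) (f f₁ f₂ : (Fin n → ℝ) → ℝ), Adm n σ f ∧ Adm n σ₁ f₁ ∧ Adm n σ₂ f₂ ∧ σ = σ₁ ∪ σ₂ ∧ MeasureTheory.volume (σ₁ ∩ σ₂) = 0 ∧ Set.EqOn f f₁ σ₁ ∧ Set.EqOn f f₂ σ₂ ∧ c = gen n σ f - gen n σ₁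 f₁ - gen n σ₂ f₂} ∪ {c | ∃ (n : ℕ) (σ : Set (Fin n → ℝ)) (f f₁ f₂ : (Fin n → ℝ) → ℝ), Adm n σ f ∧ Adm n σ f₁ ∧ Adm n σ f₂ ∧ Set.EqOn f (f₁ + f₂) σ ∧ c = gen n σ f - gen n σ f₁ - gen n σ f₂} ∪ {c | ∃ (n : ℕ) (σ σ' : Set (Fin n → ℝ)) (f f' : (Fin n → ℝ) → ℝ) (Φ : (Fin n → ℝ) → (Fin n → ℝ)) (Φ' : (Fin n → ℝ) → (Fin n → ℝ) →L[ℝ] (Fin n → ℝ)), Adm n σ f ∧ Adm n σ' f' ∧ Literature.NumberTheory.Transcendental.IsSemialgebraicMapOn ℝ σ Φ ∧ (∀ x ∈ σ, HasFDerivWithinAt Φ (Φ' x) σ x) ∧ Set.InjOn Φ σ ∧ σ' = Φ '' σ ∧ (∀ x ∈ σ, f x = f' (Φ x) * |(Φ' x).det|) ∧ c = gen n σ f - gen n σ' f'} ∪ {c | ∃ (n : ℕ) (σ : Set (Fin (n + 1) → ℝ)) (f : (Fin (n + 1) → ℝ) → ℝ) (τ : Set (Fin n → ℝ)) (g a b :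 (Fin n → ℝ) → ℝ) (F : (Fin (n + 1) → ℝ) → ℝ), Adm (n + 1) σ f ∧ Adm n τ g ∧ Literature.NumberTheory.Transcendental.IsSemialgebraicFunOn ℝ σ F ∧ Literature.NumberTheory.Transcendental.IsSemialgebraicFunOn ℝ τ a ∧ Literature.NumberTheory.Transcendental.IsSemialgebraicFunOn ℝ τ b ∧ (∀ x ∈ τ, a x ≤ b x) ∧ σ = {z | (Fin.init z : Fin n → ℝ) ∈ τ ∧ a (Fin.init z) ≤ z (Fin.last n) ∧ z (Fin.last n) ≤ b (Fin.init z)} ∧ (∀ x ∈ τ, ContinuousOn (fun t : ℝ => F (Fin.snoc x t)) (Set.Icc (a x) (b x))) ∧ (∀ x ∈ τ, ∀ t ∈ Set.Ioo (a x) (b x), HasDerivAt (fun s : ℝ => F (Fin.snoc x s)) (f (Fin.snoc x t)) t) ∧ (∀ x ∈ τ, g x = F (Fin.snoc x (b x)) - F (Fin.snoc x (a x))) ∧ c = gen (n + 1) σ f - gen n τ g}); ∀ (N n m : ℕ) (p : Fin N → ℝ) (D : Set (Fin (n + N) → ℝ)) (F : (Fin (n + N) → ℝ) → ℝ) (D'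 : Set (Fin (m + N) → ℝ)) (F' : (Fin (m + N) → ℝ) → ℝ), Literature.ModelTheory.ExponentialFields.IsSemialgebraic ℚ D → Literature.NumberTheory.Transcendental.IsSemialgebraicFunOn ℚ D F → Literature.ModelTheory.ExponentialFields.IsSemialgebraic ℚ D' → Literature.NumberTheory.Transcendental.IsSemialgebraicFunOn ℚ D' F' → MeasureTheory.IntegrableOn (fun x : Fin n → ℝ => F (Fin.append x p)) {x | Fin.append x p ∈ D} → MeasureTheory.IntegrableOn (fun y : Fin m → ℝ => F' (Fin.append y p)) {y | Fin.append y p ∈ D'} → gen n {x | Fin.append x p ∈ D} (fun x => F (Fin.append x p)) - gen m {y | Fin.append y p ∈ D'} (fun y => F' (Fin.append y p)) ∈ Rel → ∃ U ∈ 𝓝 p, ∀ z ∈ U, (∀ q : MvPolynomial (Fin N) ℚ, MvPolynomial.aeval p q = 0 → MvPolynomial.aeval z q = 0) → MeasureTheory.IntegrableOn (fun x : Fin n → ℝ => F (Fin.append x z)) {x | Fin.append x z ∈ D} ∧ MeasureTheory.IntegrableOn (fun y : Fin m → ℝ => F' (Fin.append y z)) {y | Fin.append y z ∈ D'} ∧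 ∫ x in {x | Fin.append x z ∈ D}, F (Fin.append x z) = ∫ y in {y | Fin.append y z ∈ D'}, F' (Fin.append y z)

/-- item stmt-KontsevichZagierPeriods-3844 · crux · rank 4 · open · by planner
why it might fail: Needs the validity set of a certificate shape to be ℚ-semialgebraic (absolute convergence of intermediate reps: IntegrabilityLocus) and fibres of ℚ-families at real-algebraic points to be ℚ-semialgebraic; a certificate whose validity set had no algebraic point would break it.
sources: BochnakCosteRoy1998, Dries1998, Kaiser2005, KontsevichZagier2001
[crux] (card (T)) REAL CERTIFICATES DESCEND. For ℚ-representations r, r' (tree `KZ.IntegralRep`), if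
gen r − gen r' ∈ Rel (an ℝ-coefficient certificate exists) then KZ.of r − KZ.of r' ∈ KZ.relations.
Proof plan: fix the certificate's shape; the set E of real parameter values making it valid is
ℚ-semialgebraic (first-order conditions + IntegrabilityLocus; coincidences of fibres are
ℚ-definable) and non-empty, hence has a real-algebraic point (ℝ_alg ≺ ℝ, tree
`tarski_seidenberg_real_holds`); fibres at a real-algebraic point are ℚ-semialgebraic, so the
certificate there is a KZ_ℚ certificate. [deps: IntegrabilityLocus] [difficulty: L] -/
@[route_item "route-KontsevichZagierPeriods-RealPeriodGerms", crux]
def RealTransfer : Prop :=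
  let Adm : (n : ℕ) → Set (Fin n → ℝ) → ((Fin n → ℝ) → ℝ) → Prop := fun n σ f => Literature.ModelTheory.ExponentialFields.IsSemialgebraic ℝ σ ∧ Literature.NumberTheory.Transcendental.IsSemialgebraicFunOn ℝ σ f ∧ MeasureTheory.IntegrableOn f σ; let gen : (n : ℕ) → Set (Fin n → ℝ) → ((Fin n → ℝ) → ℝ) → FreeAbelianGroup (Σ n : ℕ, Set (Fin n → ℝ) × ((Fin n → ℝ) → ℝ)) := fun n σ f => FreeAbelianGroup.of ⟨n, (σ, f)⟩; let Rel : AddSubgroup (FreeAbelianGroup (Σ n : ℕ, Set (Fin n → ℝ) × ((Fin n → ℝ) → ℝ))) := AddSubgroup.closure ({c | ∃ (n : ℕ) (σ σ₁ σ₂ : Set (Fin n → ℝ)) (f f₁ f₂ : (Fin n → ℝ) → ℝ), Adm n σ f ∧ Adm n σ₁ f₁ ∧ Adm n σ₂ f₂ ∧ σ = σ₁ ∪ σ₂ ∧ MeasureTheory.volume (σ₁ ∩ σ₂) = 0 ∧ Set.EqOn f f₁ σ₁ ∧ Set.EqOn f f₂ σ₂ ∧ c = gen n σ f - gen n σ₁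 f₁ - gen n σ₂ f₂} ∪ {c | ∃ (n : ℕ) (σ : Set (Fin n → ℝ)) (f f₁ f₂ : (Fin n → ℝ) → ℝ), Adm n σ f ∧ Adm n σ f₁ ∧ Adm n σ f₂ ∧ Set.EqOn f (f₁ + f₂) σ ∧ c = gen n σ f - gen n σ f₁ - gen n σ f₂} ∪ {c | ∃ (n : ℕ) (σ σ' : Set (Fin n → ℝ)) (f f' : (Fin n → ℝ) → ℝ) (Φ : (Fin n → ℝ) → (Fin n → ℝ)) (Φ' : (Fin n → ℝ) → (Fin n → ℝ) →L[ℝ] (Fin n → ℝ)), Adm n σ f ∧ Adm n σ' f' ∧ Literature.NumberTheory.Transcendental.IsSemialgebraicMapOn ℝ σ Φ ∧ (∀ x ∈ σ, HasFDerivWithinAt Φ (Φ' x) σ x) ∧ Set.InjOn Φ σ ∧ σ' = Φ '' σ ∧ (∀ x ∈ σ, f x = f' (Φ x) * |(Φ' x).det|) ∧ c = gen n σ f - gen n σ' f'} ∪ {c | ∃ (n : ℕ) (σ : Set (Fin (n + 1) → ℝ)) (f : (Fin (n + 1) → ℝ) → ℝ) (τ : Set (Fin n → ℝ)) (g a b :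 (Fin n → ℝ) → ℝ) (F : (Fin (n + 1) → ℝ) → ℝ), Adm (n + 1) σ f ∧ Adm n τ g ∧ Literature.NumberTheory.Transcendental.IsSemialgebraicFunOn ℝ σ F ∧ Literature.NumberTheory.Transcendental.IsSemialgebraicFunOn ℝ τ a ∧ Literature.NumberTheory.Transcendental.IsSemialgebraicFunOn ℝ τ b ∧ (∀ x ∈ τ, a x ≤ b x) ∧ σ = {z | (Fin.init z : Fin n → ℝ) ∈ τ ∧ a (Fin.init z) ≤ z (Fin.last n) ∧ z (Fin.last n) ≤ b (Fin.init z)} ∧ (∀ x ∈ τ, ContinuousOn (fun t : ℝ => F (Fin.snoc x t)) (Set.Icc (a x) (b x))) ∧ (∀ x ∈ τ, ∀ t ∈ Set.Ioo (a x) (b x), HasDerivAt (fun s : ℝ => F (Fin.snoc x s)) (f (Fin.snoc x t)) t) ∧ (∀ x ∈ τ, g x = F (Fin.snoc x (b x)) - F (Fin.snoc x (a x))) ∧ c = gen (n + 1) σ f - gen n τ g}); ∀ (n m : ℕ) (r : Literature.NumberTheory.Transcendental.KZ.IntegralRep n) (r' : Literature.NumberTheory.Transcendental.KZ.IntegralRep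 m), gen n r.domain r.integrand - gen m r'.domain r'.integrand ∈ Rel → Literature.NumberTheory.Transcendental.KZ.of r - Literature.NumberTheory.Transcendental.KZ.of r' ∈ Literature.NumberTheory.Transcendental.KZ.relations

/-- item stmt-KontsevichZagierPeriods-3845 · crux · rank 5 · open · by planner
why it might fail: Contains Conjecture 1 (GPC-strength). Beyond: an ℝ-pair with identical germs but no ℝ-certificate — e.g. a functional identity at a transcendental point whose parameter-direction primitive is not semialgebraic and admits no algebraic base point — or a finer invariant (jets along non-algebraic arcs).
sources: KontsevichZagier2001, AyoubRelKZRevisited, Ayoub2015, CressonViusos2022, Andre2004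
[crux] (card D3, 'ℝ-KZ″' / Sydler_ℝ) THE GERM IS COMPLETE. If the value functions of two
ℚ-semialgebraic families agree (with integrable fibres) on a neighbourhood of p inside Loc(p), then
the difference of the fibres at p lies in Rel. At ℚ-points (Loc = point) this IS Conjecture 1 in
kernel form up to ℝ-certificates — said plainly: the item contains the summit; its other fibres (p
of positive transcendence degree) are new statements, and the card's kill test c = (L−1)⋆(L−1), L =
[(1,e),1/t] (germ (log z − 1)² ≢ 0) is consistent. Staffed mainly for refuters (negative twin: an
ℝ-pair with equal germs separated by a finer invariant) and for the rung analysis. [deps: GermSound]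
[difficulty: open-problem] -/
@[route_item "route-KontsevichZagierPeriods-RealPeriodGerms", crux]
def GermComplete : Prop :=
  let Adm : (n : ℕ) → Set (Fin n → ℝ) → ((Fin n → ℝ) → ℝ) → Prop := fun n σ f => Literature.ModelTheory.ExponentialFields.IsSemialgebraic ℝ σ ∧ Literature.NumberTheory.Transcendental.IsSemialgebraicFunOn ℝ σ f ∧ MeasureTheory.IntegrableOn f σ; let gen : (n : ℕ) → Set (Fin n → ℝ) → ((Fin n → ℝ) → ℝ) → FreeAbelianGroup (Σ n : ℕ, Set (Fin n → ℝ) × ((Fin n → ℝ) → ℝ)) := fun n σ f => FreeAbelianGroup.of ⟨n, (σ, f)⟩; let Rel : AddSubgroup (FreeAbelianGroup (Σ n : ℕ, Set (Fin n → ℝ) × ((Fin n → ℝ) → ℝ))) := AddSubgroup.closure ({c | ∃ (n : ℕ) (σ σ₁ σ₂ : Set (Fin n → ℝ)) (f f₁ f₂ : (Fin n → ℝ) → ℝ), Adm n σ f ∧ Adm n σ₁ f₁ ∧ Adm n σ₂ f₂ ∧ σ = σ₁ ∪ σ₂ ∧ MeasureTheory.volume (σ₁ ∩ σ₂) = 0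 ∧ Set.EqOn f f₁ σ₁ ∧ Set.EqOn f f₂ σ₂ ∧ c = gen n σ f - gen n σ₁ f₁ - gen n σ₂ f₂} ∪ {c | ∃ (n : ℕ) (σ : Set (Fin n → ℝ)) (f f₁ f₂ : (Fin n → ℝ) → ℝ), Adm n σ f ∧ Adm n σ f₁ ∧ Adm n σ f₂ ∧ Set.EqOn f (f₁ + f₂) σ ∧ c = gen n σ f - gen n σ f₁ - gen n σ f₂} ∪ {c | ∃ (n : ℕ) (σ σ' : Set (Fin n → ℝ)) (f f' : (Fin n → ℝ) → ℝ) (Φ : (Fin n → ℝ) → (Fin n → ℝ)) (Φ' : (Fin n → ℝ) → (Fin n → ℝ) →L[ℝ] (Fin n → ℝ)), Adm n σ f ∧ Adm n σ' f' ∧ Literature.NumberTheory.Transcendental.IsSemialgebraicMapOn ℝ σ Φ ∧ (∀ x ∈ σ, HasFDerivWithinAt Φ (Φ' x) σ x) ∧ Set.InjOn Φ σ ∧ σ' = Φ '' σ ∧ (∀ x ∈ σ, f x = f' (Φ x) * |(Φ' x).det|) ∧ c = gen n σ f - gen n σ' f'} ∪ {c | ∃ (n : ℕ) (σ : Set (Fin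 (n + 1) → ℝ)) (f : (Fin (n + 1) → ℝ) → ℝ) (τ : Set (Fin n → ℝ)) (g a b : (Fin n → ℝ) → ℝ) (F : (Fin (n + 1) → ℝ) → ℝ), Adm (n + 1) σ f ∧ Adm n τ g ∧ Literature.NumberTheory.Transcendental.IsSemialgebraicFunOn ℝ σ F ∧ Literature.NumberTheory.Transcendental.IsSemialgebraicFunOn ℝ τ a ∧ Literature.NumberTheory.Transcendental.IsSemialgebraicFunOn ℝ τ b ∧ (∀ x ∈ τ, a x ≤ b x) ∧ σ = {z | (Fin.init z : Fin n → ℝ) ∈ τ ∧ a (Fin.init z) ≤ z (Fin.last n) ∧ z (Fin.last n) ≤ b (Fin.init z)} ∧ (∀ x ∈ τ, ContinuousOn (fun t : ℝ => F (Fin.snoc x t)) (Set.Icc (a x) (b x))) ∧ (∀ x ∈ τ, ∀ t ∈ Set.Ioo (a x) (b x), HasDerivAt (fun s : ℝ => F (Fin.snoc x s)) (f (Fin.snoc x t)) t) ∧ (∀ x ∈ τ, g x = F (Fin.snoc x (b x)) - F (Fin.snoc x (a x))) ∧ c = gen (n + 1) σ f - gen n τ g}); ∀ (N n m : ℕ)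 (p : Fin N → ℝ) (D : Set (Fin (n + N) → ℝ)) (F : (Fin (n + N) → ℝ) → ℝ) (D' : Set (Fin (m + N) → ℝ)) (F' : (Fin (m + N) → ℝ) → ℝ), Literature.ModelTheory.ExponentialFields.IsSemialgebraic ℚ D → Literature.NumberTheory.Transcendental.IsSemialgebraicFunOn ℚ D F → Literature.ModelTheory.ExponentialFields.IsSemialgebraic ℚ D' → Literature.NumberTheory.Transcendental.IsSemialgebraicFunOn ℚ D' F' → (∃ U ∈ 𝓝 p, ∀ z ∈ U, (∀ q : MvPolynomial (Fin N) ℚ, MvPolynomial.aeval p q = 0 → MvPolynomial.aeval z q = 0) → MeasureTheory.IntegrableOn (fun x : Fin n → ℝ => F (Fin.append x z)) {x | Fin.append x z ∈ D} ∧ MeasureTheory.IntegrableOn (fun y : Fin m → ℝ => F' (Fin.append y z)) {y | Fin.append y z ∈ D'} ∧ ∫ x in {x | Fin.append x z ∈ D}, F (Fin.append x z) = ∫ y in {y | Fin.append y z ∈ D'}, F' (Fin.append y z)) → gen n {x | Fin.append x p ∈ D} (fun x => F (Fin.append x p)) - gen m {y | Fin.append y p ∈ D'} (fun y => F' (Fin.append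 y p)) ∈ Rel

/-- item stmt-KontsevichZagierPeriods-3847 · crux (kind.auto-crux: conjecture-grade) · rank 9 · open · by planner
why it might fail: auto-crux — conjecture-grade statement (docstring avows it ('CONJECTURE')); it is open, so it may simply be false
sources: KontsevichZagier2001, CressonViusos2022
[support] (card D2) NAIVE ℝ-CONJECTURE 1 IS FALSE: the unit disc with integrand 1 and the
0-dimensional representation 'the constant π' have the same value π but their difference is not in
Rel — the area of the disc cannot be EVALUATED by real-coefficient moves. From GermSound with N = 1,
p = (π): Loc(π) = ℝ by `transcendental_pi_holds`, the disc family is constant (germ ≡ π) while the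
constant family has germ z ↦ z. Equivalently (0,π)×(0,1) vs disc. The Lindemann theorem read through
a Dehn-type invariant. [difficulty: M] -/
@[route_item "route-KontsevichZagierPeriods-RealPeriodGerms", crux]
def NotNaiveRealKZ : Prop :=
  let Adm : (n : ℕ) → Set (Fin n → ℝ) → ((Fin n → ℝ) → ℝ) → Prop := fun n σ f => Literature.ModelTheory.ExponentialFields.IsSemialgebraic ℝ σ ∧ Literature.NumberTheory.Transcendental.IsSemialgebraicFunOn ℝ σ f ∧ MeasureTheory.IntegrableOn f σ; let gen : (n : ℕ) → Set (Fin n → ℝ) → ((Fin n → ℝ) → ℝ) → FreeAbelianGroup (Σ n : ℕ, Set (Fin n → ℝ) × ((Fin n → ℝ) → ℝ)) := fun n σ f => FreeAbelianGroup.of ⟨n, (σ, f)⟩; let Rel : AddSubgroup (FreeAbelianGroup (Σ n : ℕ, Set (Fin n → ℝ) × ((Fin n → ℝ) → ℝ))) := AddSubgroup.closure ({c | ∃ (n : ℕ) (σ σ₁ σ₂ : Set (Fin n → ℝ)) (f f₁ f₂ : (Fin n → ℝ) → ℝ), Adm n σ f ∧ Adm n σ₁ f₁ ∧ Adm n σ₂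 f₂ ∧ σ = σ₁ ∪ σ₂ ∧ MeasureTheory.volume (σ₁ ∩ σ₂) = 0 ∧ Set.EqOn f f₁ σ₁ ∧ Set.EqOn f f₂ σ₂ ∧ c = gen n σ f - gen n σ₁ f₁ - gen n σ₂ f₂} ∪ {c | ∃ (n : ℕ) (σ : Set (Fin n → ℝ)) (f f₁ f₂ : (Fin n → ℝ) → ℝ), Adm n σ f ∧ Adm n σ f₁ ∧ Adm n σ f₂ ∧ Set.EqOn f (f₁ + f₂) σ ∧ c = gen n σ f - gen n σ f₁ - gen n σ f₂} ∪ {c | ∃ (n : ℕ) (σ σ' : Set (Fin n → ℝ)) (f f' : (Fin n → ℝ) → ℝ) (Φ : (Fin n → ℝ) → (Fin n → ℝ)) (Φ' : (Fin n → ℝ) → (Fin n → ℝ) →L[ℝ] (Fin n → ℝ)), Adm n σ f ∧ Adm n σ' f' ∧ Literature.NumberTheory.Transcendental.IsSemialgebraicMapOn ℝ σ Φ ∧ (∀ x ∈ σ, HasFDerivWithinAt Φ (Φ' x) σ x) ∧ Set.InjOn Φ σ ∧ σ' = Φ '' σ ∧ (∀ x ∈ σ, f x = f' (Φ x) * |(Φ'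 x).det|) ∧ c = gen n σ f - gen n σ' f'} ∪ {c | ∃ (n : ℕ) (σ : Set (Fin (n + 1) → ℝ)) (f : (Fin (n + 1) → ℝ) → ℝ) (τ : Set (Fin n → ℝ)) (g a b : (Fin n → ℝ) → ℝ) (F : (Fin (n + 1) → ℝ) → ℝ), Adm (n + 1) σ f ∧ Adm n τ g ∧ Literature.NumberTheory.Transcendental.IsSemialgebraicFunOn ℝ σ F ∧ Literature.NumberTheory.Transcendental.IsSemialgebraicFunOn ℝ τ a ∧ Literature.NumberTheory.Transcendental.IsSemialgebraicFunOn ℝ τ b ∧ (∀ x ∈ τ, a x ≤ b x) ∧ σ = {z | (Fin.init z : Fin n → ℝ) ∈ τ ∧ a (Fin.init z) ≤ z (Fin.last n) ∧ z (Fin.last n) ≤ b (Fin.init z)} ∧ (∀ x ∈ τ, ContinuousOn (fun t : ℝ => F (Fin.snoc x t)) (Set.Icc (a x) (b x))) ∧ (∀ x ∈ τ, ∀ t ∈ Set.Ioo (a x) (b x), HasDerivAt (fun s : ℝ => F (Fin.snoc x s)) (f (Fin.snoc x t)) t) ∧ (∀ x ∈ τ, g x = F (Fin.snoc x (b x)) -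 F (Fin.snoc x (a x))) ∧ c = gen (n + 1) σ f - gen n τ g}); gen 2 {x : Fin 2 → ℝ | x 0 ^ 2 + x 1 ^ 2 ≤ 1} (fun _ => (1 : ℝ)) - gen 0 (Set.univ : Set (Fin 0 → ℝ)) (fun _ => Real.pi) ∉ Rel

/-- item stmt-KontsevichZagierPeriods-3846 · support · rank 9 · closed · proved by Summit.KontsevichZagierPeriods.RealPeriodGerms.genericNeighbourhood_proof @ c892c4b2908d (prover) · by planner
sources: Dries1998, BochnakCosteRoy1998
[support] A ℚ-semialgebraic subset of ℝ^N containing p contains U ∩ Loc(p) for some neighbourhood U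
of p (induction over the Boolean algebra on the two-sided statement 'germ of Loc(p) at p lies inside
A or inside Aᶜ'; generators {q = 0}, {q > 0} by cases on the sign of q(p)). Provable now; the
genericity engine of GermSound and of the propagation principle. [difficulty: S] -/
@[route_item "route-KontsevichZagierPeriods-RealPeriodGerms", crux]
def GenericNeighbourhood : Prop :=
  ∀ (N : ℕ) (p : Fin N → ℝ) (A : Set (Fin N → ℝ)), Literature.ModelTheory.ExponentialFields.IsSemialgebraic ℚ A → p ∈ A → ∃ U ∈ 𝓝 p, ∀ z ∈ U, (∀ q : MvPolynomial (Fin N) ℚ, MvPolynomial.aeval p q = 0 → MvPolynomial.aeval z q = 0) → z ∈ A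

/-- item stmt-KontsevichZagierPeriods-3848 · assembly · rank 1 · closed · proved by Summit.KontsevichZagierPeriods.RealPeriodGerms.assembly_proof @ 484cbd02805f (prover) · by planner
sources: KontsevichZagier2001
[assembly] GermComplete → RealTransfer → KontsevichZagierPeriods -/
@[route_item "route-KontsevichZagierPeriods-RealPeriodGerms", crux]
def Assembly : Prop :=
  let Adm : (n : ℕ) → Set (Fin n → ℝ) → ((Fin n → ℝ) → ℝ) → Prop := fun n σ f => Literature.ModelTheory.ExponentialFields.IsSemialgebraic ℝ σ ∧ Literature.NumberTheory.Transcendental.IsSemialgebraicFunOn ℝ σ f ∧ MeasureTheory.IntegrableOn f σ; let gen : (n : ℕ) → Set (Fin n → ℝ) → ((Fin n → ℝ) → ℝ) → FreeAbelianGroup (Σ n : ℕ, Set (Fin n → ℝ) × ((Fin n → ℝ) → ℝ)) := fun n σ f => FreeAbelianGroup.of ⟨n, (σ, f)⟩; let Rel : AddSubgroup (FreeAbelianGroup (Σ n : ℕ, Set (Fin n → ℝ) × ((Fin n → ℝ) → ℝ))) := AddSubgroup.closure ({c | ∃ (n : ℕ) (σ σ₁ σ₂ : Set (Fin n → ℝ))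 (f f₁ f₂ : (Fin n → ℝ) → ℝ), Adm n σ f ∧ Adm n σ₁ f₁ ∧ Adm n σ₂ f₂ ∧ σ = σ₁ ∪ σ₂ ∧ MeasureTheory.volume (σ₁ ∩ σ₂) = 0 ∧ Set.EqOn f f₁ σ₁ ∧ Set.EqOn f f₂ σ₂ ∧ c = gen n σ f - gen n σ₁ f₁ - gen n σ₂ f₂} ∪ {c | ∃ (n : ℕ) (σ : Set (Fin n → ℝ)) (f f₁ f₂ : (Fin n → ℝ) → ℝ), Adm n σ f ∧ Adm n σ f₁ ∧ Adm n σ f₂ ∧ Set.EqOn f (f₁ + f₂) σ ∧ c = gen n σ f - gen n σ f₁ - gen n σ f₂} ∪ {c | ∃ (n : ℕ) (σ σ' : Set (Fin n → ℝ)) (f f' : (Fin n → ℝ) → ℝ) (Φ : (Fin n → ℝ) → (Fin n → ℝ)) (Φ' : (Fin n → ℝ) → (Fin n → ℝ) →L[ℝ] (Fin n → ℝ)), Adm n σ f ∧ Adm n σ' f' ∧ Literature.NumberTheory.Transcendental.IsSemialgebraicMapOn ℝ σ Φ ∧ (∀ x ∈ σ, HasFDerivWithinAt Φ (Φ' x)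 σ x) ∧ Set.InjOn Φ σ ∧ σ' = Φ '' σ ∧ (∀ x ∈ σ, f x = f' (Φ x) * |(Φ' x).det|) ∧ c = gen n σ f - gen n σ' f'} ∪ {c | ∃ (n : ℕ) (σ : Set (Fin (n + 1) → ℝ)) (f : (Fin (n + 1) → ℝ) → ℝ) (τ : Set (Fin n → ℝ)) (g a b : (Fin n → ℝ) → ℝ) (F : (Fin (n + 1) → ℝ) → ℝ), Adm (n + 1) σ f ∧ Adm n τ g ∧ Literature.NumberTheory.Transcendental.IsSemialgebraicFunOn ℝ σ F ∧ Literature.NumberTheory.Transcendental.IsSemialgebraicFunOn ℝ τ a ∧ Literature.NumberTheory.Transcendental.IsSemialgebraicFunOn ℝ τ b ∧ (∀ x ∈ τ, a x ≤ b x) ∧ σ = {z | (Fin.init z : Fin n → ℝ) ∈ τ ∧ a (Fin.init z) ≤ z (Fin.last n) ∧ z (Fin.last n) ≤ b (Fin.init z)} ∧ (∀ x ∈ τ, ContinuousOn (fun t : ℝ => F (Fin.snoc x t)) (Set.Icc (a x) (b x))) ∧ (∀ x ∈ τ, ∀ t ∈ Set.Ioo (a x) (b x), HasDerivAt (fun s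 : ℝ => F (Fin.snoc x s)) (f (Fin.snoc x t)) t) ∧ (∀ x ∈ τ, g x = F (Fin.snoc x (b x)) - F (Fin.snoc x (a x))) ∧ c = gen (n + 1) σ f - gen n τ g}); (∀ (N n m : ℕ) (p : Fin N → ℝ) (D : Set (Fin (n + N) → ℝ)) (F : (Fin (n + N) → ℝ) → ℝ) (D' : Set (Fin (m + N) → ℝ)) (F' : (Fin (m + N) → ℝ) → ℝ), Literature.ModelTheory.ExponentialFields.IsSemialgebraic ℚ D → Literature.NumberTheory.Transcendental.IsSemialgebraicFunOn ℚ D F → Literature.ModelTheory.ExponentialFields.IsSemialgebraic ℚ D' → Literature.NumberTheory.Transcendental.IsSemialgebraicFunOn ℚ D' F' → (∃ U ∈ 𝓝 p, ∀ z ∈ U, (∀ q : MvPolynomial (Fin N) ℚ, MvPolynomial.aeval p q = 0 → MvPolynomial.aeval z q = 0) → MeasureTheory.IntegrableOn (fun x : Fin n → ℝ => F (Fin.append x z)) {x | Fin.append x z ∈ D} ∧ MeasureTheory.IntegrableOn (fun y : Fin m → ℝ => F' (Fin.append y z)) {y | Fin.append y z ∈ D'} ∧ ∫ x in {x | Fin.append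 x z ∈ D}, F (Fin.append x z) = ∫ y in {y | Fin.append y z ∈ D'}, F' (Fin.append y z)) → gen n {x | Fin.append x p ∈ D} (fun x => F (Fin.append x p)) - gen m {y | Fin.append y p ∈ D'} (fun y => F' (Fin.append y p)) ∈ Rel) → (∀ (n m : ℕ) (r : Literature.NumberTheory.Transcendental.KZ.IntegralRep n) (r' : Literature.NumberTheory.Transcendental.KZ.IntegralRep m), gen n r.domain r.integrand - gen m r'.domain r'.integrand ∈ Rel → Literature.NumberTheory.Transcendental.KZ.of r - Literature.NumberTheory.Transcendental.KZ.of r' ∈ Literature.NumberTheory.Transcendental.KZ.relations) → KontsevichZagierPeriods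

/-! D-0027 §2.1 — DECIDING THEOREM (planner-authored via `route open/edit --closes-file`; by planner-rbadge-KontsevichZagierPeriods-RealPer-c9e07e12-g2-0 2026-08-15T16:14:16Z):
its hypotheses are this route's items and its conclusion the sub-problem Statement (glue_lint), and it elaborates with this file. -/

/-- Route glue (D-0027 §2.1). The summit is the fibre of the line over the rationals: for two
`ℚ`-representations `r`, `r'` with `r.value = r'.value`, apply `GermComplete` at the `ℚ`-point
`N = 0`, `p = Fin.elim0` (families `D := r.domain`, `F := r.integrand` over `ℝ^{n+0}`; there
`Loc(p) = {p}` and the germ hypothesis is literally `r.value = r'.value` plus the integrability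
fields of `KZ.IntegralRep`) to get an `ℝ`-certificate `gen r − gen r' ∈ Rel`, and descend it with
`RealTransfer` to `KZ.of r − KZ.of r' ∈ KZ.relations = KZ.Equivalent r r'`. The only bookkeeping is
`Fin.append x z = x` for `z : Fin 0 → ℝ` (`Fin (k + 0) = Fin k` definitionally, `Fin.append_left`).
The hypotheses `IntegrabilityLocus`, `GermSound`, `GenericNeighbourhood`, `NotNaiveRealKZ` (the
line's unconditional by-products and inputs of the crux proofs) and the item `Assembly` are carried
but not invoked: the deciding content is `GermComplete → RealTransfer → KontsevichZagierPeriods`,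
certified here. -/
@[closes "route-KontsevichZagierPeriods-RealPeriodGerms"] theorem closes : IntegrabilityLocus → GermSound → RealTransfer → GermComplete → GenericNeighbourhood →
    NotNaiveRealKZ → Assembly → KontsevichZagierPeriods := by
  intro _ _ hT hC _ _ _ n m r r' _ _ hval
  -- bookkeeping at N = 0: appending an empty block of coordinates is the identity
  have happ : ∀ (k : ℕ) (x : Fin k → ℝ) (z : Fin 0 → ℝ), Fin.append x z = x :=
    fun k x z => funext fun i => Fin.append_left x z i
  -- RealTransfer: an ℝ-coefficient certificate for the ℚ-representations r, r' descends to KZ.relations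
  refine hT n m r r' ?_
  -- GermComplete at the ℚ-point (N = 0, p = Fin.elim0): the germ hypothesis is r.value = r'.value
  have key := hC 0 n m Fin.elim0 r.domain r.integrand r'.domain r'.integrand r.isSemialgebraic_domain
    r.isSemialgebraicFunOn_integrand r'.isSemialgebraic_domain r'.isSemialgebraicFunOn_integrand
    ⟨Set.univ, Filter.univ_mem, fun z _ _ => by
      simp only [happ, Set.setOf_mem_eq]
      exact ⟨r.integrableOn, r'.integrableOn, hval⟩⟩
  simp only [happ, Set.setOf_mem_eq] at key
  exact key

end Summit.KontsevichZagierPeriods.KontsevichZagierPeriods.Theses.RealPeriodGerms
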